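import Mathlib
import Literature.Analysis.FluidPDE.SelfSimilarEulerOutgoingExclusionTools
import HarnessLib

/-!
# HEAD GAIN ALONG AN OUTFLOW ARC — stub D2 `stub_headGain` of line `outflow_dive` (ns-idea-11 g7) for the crux
# `EulerZoomLiouville.PowerGaugeEulerLiouville` (stmt-NavierStokesRegularity-19832, THE ONE STATEMENT `stub_selfSimilarC2Needle`; width seat ns-ezl-w1 g5)

Route №10 `EulerZoomLiouville` (NavierStokesRegularity).  Class-free calculus along a backward similarity orbit: let `(V, P′)` be a `C²`
self-similar Euler profile on `ℝ³` (exponent `γ = 1/(2+ρ)`, centre `0`), `W = γy + V`, `ℋ` its Bernoulli function, and `Y : [0, σ₁] → ℝ³` a `C¹`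
arc with `Y′ = −W(Y)` which is `c₁`-FAST OUTFLOW, `⟪Y, W(Y)⟫ ≥ c₁‖Y‖²` (`c₁ > 0`).  Then

  `ℋ(Y σ₁) ≥ ℋ(Y 0) + ½(1−2γ)c₁(‖Y 0‖² − ‖Y σ₁‖²)`     (`headGain`, the text of `Sig.stub_headGain` verbatim):

the arc LOSES radius (`(‖Y‖²)′ = −2⟪Y, W(Y)⟫ ≤ −2c₁‖Y‖²`) and GAINS head at least proportionally — `(ℋ∘Y)′ = (1−2γ)‖W(Y)‖²` (CIV (3.31)) and
`‖W(Y)‖² ≥ c₁⟪Y, W(Y)⟫` (Cauchy–Schwarz with `‖W‖ ≥ c₁‖Y‖`), so `ℋ∘Y + ½(1−2γ)c₁‖Y‖²` is non-decreasing on `[0, σ₁]`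
(`monotoneOn_of_hasDerivWithinAt_nonneg`).  With D1 (`stub_outflowExit`) and D3 (`stub_vorticityTransport`) it composes to `stub_outflowDive`
(«outflow is not a face»: a far c₁-fast OUTFLOW vortical Bernoulli-high point dives back to the swirl range) — the turning heads produced by the
flux law (`…SelfSimilarHighSetFlux`) are sent back into the T1/T2 faces.

HONEST LABEL: class-free calculus stub of a files-only line; nothing here excludes a needle.  WHAT THIS IS NOT: not NS, not E — `--supports` stmt-19832
on the MODEL lattice; 19832 OPEN; NS regularity NOT proved. [folklore; ConstantinIgnatovaVicol2026Putative §3.4.3 (3.31)]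
-/

noncomputable section

-- flat `Theorems/<Route><Decl>…` files of one crux share the namespace of the crux (tree convention)
set_option linter.dupNamespace false

open MeasureTheory Set Filter Topology Metric Function InnerProductSpace
open scoped RealInnerProductSpace NNReal ENNReal

namespace Summit.NavierStokesRegularity.NavierStokesRegularity.Theorems.PowerGaugeEulerLiouville.OutflowDive

open Literature.Analysis Literature.Analysis.FluidPDE

/-- Cauchy–Schwarz at a `c₁`-fast outflow point: `c₁‖y‖² ≤ ⟪y, w⟫` (`c₁ > 0`) implies `c₁⟪y, w⟫ ≤ ‖w‖²`
(`⟪y,w⟫ ≤ ‖y‖‖w‖` and `c₁‖y‖ ≤ ‖w‖`). [folklore] -/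
theorem mul_inner_le_norm_sq_of_fast {c₁ : ℝ} (hc₁ : 0 < c₁) {y w : EuclideanSpace ℝ (Fin 3)}
    (hfast : c₁ * ‖y‖ ^ 2 ≤ ⟪y, w⟫) : c₁ * ⟪y, w⟫ ≤ ‖w‖ ^ 2 := by
  have hcs : ⟪y, w⟫ ≤ ‖y‖ * ‖w‖ := real_inner_le_norm _ _
  have hy0 : 0 ≤ ‖y‖ := norm_nonneg _
  have hw0 : 0 ≤ ‖w‖ := norm_nonneg _
  by_cases hy : ‖y‖ = 0
  · have hyz : y = 0 := norm_eq_zero.1 hy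
    simp [hyz]
  · have hypos : 0 < ‖y‖ := lt_of_le_of_ne hy0 (Ne.symm hy)
    -- `c₁‖y‖ ≤ ‖w‖`
    have h1 : c₁ * ‖y‖ ≤ ‖w‖ := by
      have : c₁ * ‖y‖ * ‖y‖ ≤ ‖w‖ * ‖y‖ := by nlinarith
      exact le_of_mul_le_mul_right this hypos
    calc c₁ * ⟪y, w⟫ ≤ c₁ * (‖y‖ * ‖w‖) := mul_le_mul_of_nonneg_left hcs hc₁.le
      _ = (c₁ * ‖y‖) * ‖w‖ := by ring
      _ ≤ ‖w‖ * ‖w‖ := mul_le_mul_of_nonneg_right h1 hw0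
      _ = ‖w‖ ^ 2 := by ring

/-- **HEAD GAIN ALONG AN OUTFLOW ARC** (the text of `Sig.stub_headGain` of line `outflow_dive`, verbatim).  For a `C²` self-similar Euler
profile `(V, P′)` on `ℝ³` (`γ = 1/(2+ρ)`, `0 < ρ ≤ ½`, centre `0`), `c₁ > 0`, `σ₁ ≥ 0` and an arc `Y` with `Y′ = −W(Y)` on `[0, σ₁]` which is
`c₁`-fast outflow there:  `ℋ(Y 0) + ½(1−2γ)c₁(‖Y 0‖² − ‖Y σ₁‖²) ≤ ℋ(Y σ₁)`. [folklore; ConstantinIgnatovaVicol2026Putative §3.4.3 (3.31)] -/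
theorem headGain :
    ∀ ρ : ℝ, 0 < ρ → ρ ≤ 1 / 2 →
    ∀ (V : EuclideanSpace ℝ (Fin 3) → EuclideanSpace ℝ (Fin 3)) (P' : EuclideanSpace ℝ (Fin 3) → ℝ),
      IsSelfSimilarEulerProfile (1 / (2 + ρ)) 0 V P' →
      ∀ c₁ : ℝ, 0 < c₁ → ∀ σ₁ : ℝ, 0 ≤ σ₁ → ∀ Y : ℝ → EuclideanSpace ℝ (Fin 3),
        (∀ σ ∈ Set.Icc 0 σ₁, HasDerivAt Y (-(selfSimilarTransport (1 / (2 + ρ)) 0 V (Y σ))) σ) →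
        (∀ σ ∈ Set.Icc 0 σ₁, c₁ * ‖Y σ‖ ^ 2 ≤ inner ℝ (Y σ) (selfSimilarTransport (1 / (2 + ρ)) 0 V (Y σ))) →
        selfSimilarBernoulli (1 / (2 + ρ)) 0 V P' (Y 0) +
            1 / 2 * (1 - 2 * (1 / (2 + ρ))) * c₁ * (‖Y 0‖ ^ 2 - ‖Y σ₁‖ ^ 2) ≤
          selfSimilarBernoulli (1 / (2 + ρ)) 0 V P' (Y σ₁) := by
  intro ρ hρ hρh V P' hprof c₁ hc₁ σ₁ hσ₁ Y hY hfast
  set γ : ℝ := 1 / (2 + ρ) with hγdef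
  set W : EuclideanSpace ℝ (Fin 3) → EuclideanSpace ℝ (Fin 3) := selfSimilarTransport γ 0 V with hWdef
  set Hf : EuclideanSpace ℝ (Fin 3) → ℝ := selfSimilarBernoulli γ 0 V P' with hHdef
  have h2ρ : (0 : ℝ) < 2 + ρ := by linarith
  have h12 : 0 ≤ 1 - 2 * γ := by
    rw [hγdef]
    have : 1 / (2 + ρ) ≤ 1 / 2 := one_div_le_one_div_of_le two_pos (by linarith)
    linarith
  -- the monotone quantity `φ = ℋ∘Y + ½(1−2γ)c₁‖Y‖²`
  set φ : ℝ → ℝ := fun σ => Hf (Y σ) + 1 / 2 * (1 - 2 * γ) * c₁ * ‖Y σ‖ ^ 2 with hφdef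
  set φ' : ℝ → ℝ := fun σ => (1 - 2 * γ) * (‖W (Y σ)‖ ^ 2 - c₁ * ⟪Y σ, W (Y σ)⟫) with hφ'def
  have hHd : Differentiable ℝ Hf := hprof.contDiff_selfSimilarBernoulli.differentiable one_ne_zero
  -- derivative of `φ` on `[0, σ₁]`
  have hderiv : ∀ σ ∈ Icc 0 σ₁, HasDerivAt φ (φ' σ) σ := by
    intro σ hσ
    have hYσ := hY σ hσ
    have h1 : HasDerivAt (fun s => Hf (Y s)) (fderiv ℝ Hf (Y σ) (-(W (Y σ)))) σ :=
      (hHd (Y σ)).hasFDerivAt.comp_hasDerivAt σ hYσ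
    rw [map_neg, hprof.fderiv_selfSimilarBernoulli_transport (Y σ)] at h1
    have h2 : HasDerivAt (fun s => ‖Y s‖ ^ 2) (2 * ⟪Y σ, -(W (Y σ))⟫) σ := hYσ.norm_sq
    have h3 := h1.add (h2.const_mul (1 / 2 * (1 - 2 * γ) * c₁))
    refine h3.congr_deriv ?_
    simp only [hφ'def, inner_neg_right]
    ring
  -- `φ' ≥ 0`
  have hφ'0 : ∀ σ ∈ Icc 0 σ₁, 0 ≤ φ' σ := fun σ hσ =>
    mul_nonneg h12 (sub_nonneg.2 (mul_inner_le_norm_sq_of_fast hc₁ (hfast σ hσ)))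
  -- monotone on `[0, σ₁]`
  have hcont : ContinuousOn φ (Icc 0 σ₁) := fun σ hσ => (hderiv σ hσ).continuousAt.continuousWithinAt
  have hmono : MonotoneOn φ (Icc 0 σ₁) := by
    refine monotoneOn_of_hasDerivWithinAt_nonneg (f' := φ') (convex_Icc 0 σ₁) hcont (fun σ hσ => ?_) (fun σ hσ => ?_)
    · rw [interior_Icc] at hσ ⊢
      exact (hderiv σ (Ioo_subset_Icc_self hσ)).hasDerivWithinAt
    · rw [interior_Icc] at hσ
      exact hφ'0 σ (Ioo_subset_Icc_self hσ)
  have hle : φ 0 ≤ φ σ₁ := hmono (left_mem_Icc.2 hσ₁) (right_mem_Icc.2 hσ₁) hσ₁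
  simp only [hφdef] at hle
  linarith

end Summit.NavierStokesRegularity.NavierStokesRegularity.Theorems.PowerGaugeEulerLiouville.OutflowDive

end
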